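import Literature.NumberTheory.Automorphic.GLnCongruenceSubgroups
import Mathlib.RingTheory.LocalRing.ResidueField.Basic
import HarnessLib

/-!
# Reduction modulo `𝓂` of integral matrices over a valued field

Topic `NumberTheory/Automorphic`; namespace `Literature.NumberTheory.Automorphic.IntegralReduction`.  KERNEL only:
definitions with bodies and proved lemmas; no named fact, no `sorry`.

For a field `K` with a valuative relation (valuation ring `𝒪 = 𝒪[K]`, residue field `𝓀 = 𝓀[K]`, Mathlib's
`IsLocalRing.residue`) we set up the bookkeeping used when an argument over `𝓀` is lifted to `𝒪`-points:
* `red : K → 𝓀`, the residue map extended by `0` off `𝒪` (a TOTAL function, so that statements about matrices over `K`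
  with integral entries need no subtype juggling), multiplicative and additive on `𝒪` (`red_mul`, `red_one`, `red_two`);
  `red x ≠ 0 ↔ |x| = 1` on `𝒪` (`valuation_eq_one_of_red_ne_zero`, `red_ne_zero_of_valuation_eq_one`);
* `redMat M = M.map red`; on INTEGRAL matrices (`ValBound 1`, tree `GLnCongruenceSubgroups`) it is a ring
  homomorphism (`redMat_mul/add/sub/one/smul`, `red_det`), commutes with transposition and blocks;
* an endomorphism `σ` of `K` preserving the valuation restricts to a local homomorphism of `𝒪` (`integerMap`) and
  descends to `σ̄ = residueInvolution σ : 𝓀 →+* 𝓀` with `σ̄ ∘ red = red ∘ σ` (`residueInvolution_red`, `redMat_map`),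
  an involution when `σ` is (`residueInvolution_involutive`).
This is the reduction step «`K_v = G(𝒪_v) → G(𝓀_v)`» of [GelbartRogawski1991, §3.1 (3.1.3)] ∕ [MoeglinVignerasWaldspurger1987,
Chap. 2 II.10] (unramified vectors), written for the kernel construction of [GelbartRogawski1991, Prop. 3.1.1]
(stage-1 cell `pub-hodgecm`, seat GR-1, brick L7a; consumer `UnitaryGroupDoubledIntegralWitness`).

## References

* S. Gelbart, J. Rogawski, Invent. Math. 105 (1991) 445–472, §3.1 (3.1.3) [GelbartRogawski1991].
* C. Mœglin, M.-F. Vignéras, J.-L. Waldspurger, LNM 1291 (1987), Chap. 2 II.10 [MoeglinVignerasWaldspurger1987].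
* N. Iwahori, H. Matsumoto, Publ. Math. IHÉS 25 (1965), §2 (reduction mod `𝔓`) [IwahoriMatsumoto1965].
-/

set_option autoImplicit false

noncomputable section

open scoped Matrix MatrixGroups ValuativeRel
open Matrix ValuativeRel

namespace Literature.NumberTheory.Automorphic.IntegralReduction

variable {K : Type*} [Field K] [ValuativeRel K] {ι : Type*} [Fintype ι] [DecidableEq ι]

/-! ## §1 The total reduction map `red : K → 𝓀` and its behaviour on integral matrices -/

/-- **reduction modulo `𝓂`, extended by `0` off `𝒪`**: `red x = x̄` for `x ∈ 𝒪`. [cite: IwahoriMatsumoto1965, §2 (reduction mod 𝔓)] -/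
def red (x : K) : 𝓀[K] :=
  open scoped Classical in
  if h : x ∈ 𝒪[K] then IsLocalRing.residue 𝒪[K] ⟨x, h⟩ else 0

omit [Fintype ι] [DecidableEq ι] in
/-- `red` on `𝒪` is the residue map. [cite: IwahoriMatsumoto1965, §2 (reduction mod 𝔓)] -/
theorem red_coe (x : 𝒪[K]) : red (x : K) = IsLocalRing.residue 𝒪[K] x := by
  unfold red
  rw [dif_pos x.2]

omit [Fintype ι] [DecidableEq ι] in
/-- `red` is multiplicative on `𝒪`. [cite: IwahoriMatsumoto1965, §2 (reduction mod 𝔓)] -/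
theorem red_mul {x y : K} (hx : x ∈ 𝒪[K]) (hy : y ∈ 𝒪[K]) : red (x * y) = red x * red y := by
  have h1 : red x = IsLocalRing.residue 𝒪[K] ⟨x, hx⟩ := red_coe ⟨x, hx⟩
  have h2 : red y = IsLocalRing.residue 𝒪[K] ⟨y, hy⟩ := red_coe ⟨y, hy⟩
  have h3 : red (x * y) = IsLocalRing.residue 𝒪[K] ((⟨x, hx⟩ : 𝒪[K]) * ⟨y, hy⟩) := red_coe ((⟨x, hx⟩ : 𝒪[K]) * ⟨y, hy⟩)
  rw [h1, h2, h3, _root_.map_mul]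

omit [Fintype ι] [DecidableEq ι] in
/-- `red` commutes with negation on `𝒪`. [cite: IwahoriMatsumoto1965, §2 (reduction mod 𝔓)] -/
theorem red_neg {x : K} (hx : x ∈ 𝒪[K]) : red (-x) = -red x := by
  have h1 : red x = IsLocalRing.residue 𝒪[K] ⟨x, hx⟩ := red_coe ⟨x, hx⟩
  have h2 : red (-x) = IsLocalRing.residue 𝒪[K] (-⟨x, hx⟩) := red_coe (-⟨x, hx⟩)
  rw [h1, h2, map_neg]

omit [Fintype ι] [DecidableEq ι] in
/-- `red 1 = 1`. [cite: IwahoriMatsumoto1965, §2 (reduction mod 𝔓)] -/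
theorem red_one : red (1 : K) = 1 := by
  have h : red ((1 : 𝒪[K]) : K) = 1 := by rw [red_coe, map_one]
  exact h

omit [Fintype ι] [DecidableEq ι] in
/-- `red 2 = 2`. [cite: IwahoriMatsumoto1965, §2 (reduction mod 𝔓)] -/
theorem red_two : red (2 : K) = 2 := by
  have h : red ((2 : 𝒪[K]) : K) = 2 := by rw [red_coe, map_ofNat]
  have e : ((2 : 𝒪[K]) : K) = 2 := by norm_cast
  rwa [e] at h

/-- reduction of matrices, entrywise. [cite: IwahoriMatsumoto1965, §2 (reduction mod 𝔓)] -/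
def redMat {m m' : Type*} (M : Matrix m m' K) : Matrix m m' 𝓀[K] := M.map red

omit [Fintype ι] [DecidableEq ι] in
/-- `redMat` of a matrix over `𝒪` is its image under the residue map. [cite: IwahoriMatsumoto1965, §2 (reduction mod 𝔓)] -/
theorem redMat_mapMatrix {m : Type*} [Fintype m] [DecidableEq m] (M₀ : Matrix m m 𝒪[K]) :
    redMat ((𝒪[K]).subtype.mapMatrix M₀) = (IsLocalRing.residue 𝒪[K]).mapMatrix M₀ := by
  ext i j
  simp only [redMat, RingHom.mapMatrix_apply, Matrix.map_apply, Subring.coe_subtype, red_coe]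

omit [Fintype ι] [DecidableEq ι] in
/-- `redMat` is multiplicative on integral matrices. [cite: IwahoriMatsumoto1965, §2 (reduction mod 𝔓)] -/
theorem redMat_mul {m : Type*} [Fintype m] [DecidableEq m] {M N : Matrix m m K} (hM : ValBound 1 M) (hN : ValBound 1 N) :
    redMat (M * N) = redMat M * redMat N := by
  obtain ⟨M₀, rfl⟩ := exists_mapMatrix_eq_of_valBound_one hM
  obtain ⟨N₀, rfl⟩ := exists_mapMatrix_eq_of_valBound_one hN
  rw [← _root_.map_mul, redMat_mapMatrix, redMat_mapMatrix, redMat_mapMatrix, _root_.map_mul]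

omit [Fintype ι] [DecidableEq ι] in
/-- `redMat` is additive on integral matrices. [cite: IwahoriMatsumoto1965, §2 (reduction mod 𝔓)] -/
theorem redMat_add {m : Type*} [Fintype m] [DecidableEq m] {M N : Matrix m m K} (hM : ValBound 1 M) (hN : ValBound 1 N) :
    redMat (M + N) = redMat M + redMat N := by
  obtain ⟨M₀, rfl⟩ := exists_mapMatrix_eq_of_valBound_one hM
  obtain ⟨N₀, rfl⟩ := exists_mapMatrix_eq_of_valBound_one hN
  rw [← map_add, redMat_mapMatrix, redMat_mapMatrix, redMat_mapMatrix, map_add]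

omit [Fintype ι] [DecidableEq ι] in
/-- `redMat` commutes with subtraction on integral matrices. [cite: IwahoriMatsumoto1965, §2 (reduction mod 𝔓)] -/
theorem redMat_sub {m : Type*} [Fintype m] [DecidableEq m] {M N : Matrix m m K} (hM : ValBound 1 M) (hN : ValBound 1 N) :
    redMat (M - N) = redMat M - redMat N := by
  obtain ⟨M₀, rfl⟩ := exists_mapMatrix_eq_of_valBound_one hM
  obtain ⟨N₀, rfl⟩ := exists_mapMatrix_eq_of_valBound_one hN
  rw [← map_sub, redMat_mapMatrix, redMat_mapMatrix, redMat_mapMatrix, map_sub]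

omit [Fintype ι] [DecidableEq ι] in
/-- `redMat 1 = 1`. [cite: IwahoriMatsumoto1965, §2 (reduction mod 𝔓)] -/
theorem redMat_one {m : Type*} [Fintype m] [DecidableEq m] : redMat (1 : Matrix m m K) = 1 := by
  have h : (𝒪[K]).subtype.mapMatrix (1 : Matrix m m 𝒪[K]) = 1 := map_one _
  rw [← h, redMat_mapMatrix, map_one]

omit [Fintype ι] [DecidableEq ι] in
/-- `redMat` commutes with transposition. [cite: IwahoriMatsumoto1965, §2 (reduction mod 𝔓)] -/
theorem redMat_transpose {m m' : Type*} (M : Matrix m m' K) : redMat Mᵀ = (redMat M)ᵀ := by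
  ext i j; rfl

omit [Fintype ι] [DecidableEq ι] in
/-- `red (det M) = det (redMat M)` for integral `M`. [cite: IwahoriMatsumoto1965, §2 (reduction mod 𝔓)] -/
theorem red_det {m : Type*} [Fintype m] [DecidableEq m] {M : Matrix m m K} (hM : ValBound 1 M) :
    red M.det = (redMat M).det := by
  obtain ⟨M₀, rfl⟩ := exists_mapMatrix_eq_of_valBound_one hM
  rw [redMat_mapMatrix, ← RingHom.map_det, ← RingHom.map_det, Subring.coe_subtype, red_coe]

omit [Fintype ι] [DecidableEq ι] in
/-- `red (a • M) = ā • redMat M` for integral `a`, `M`. [cite: IwahoriMatsumoto1965, §2 (reduction mod 𝔓)] -/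
theorem redMat_smul {m : Type*} [Fintype m] [DecidableEq m] {a : K} (ha : a ∈ 𝒪[K]) {M : Matrix m m K} (hM : ValBound 1 M) :
    redMat (a • M) = red a • redMat M := by
  obtain ⟨M₀, rfl⟩ := exists_mapMatrix_eq_of_valBound_one hM
  have : a • (𝒪[K]).subtype.mapMatrix M₀ = (𝒪[K]).subtype.mapMatrix ((⟨a, ha⟩ : 𝒪[K]) • M₀) := by
    ext i j; simp [RingHom.mapMatrix_apply]
  rw [this, redMat_mapMatrix, redMat_mapMatrix]
  ext i j
  simp only [RingHom.mapMatrix_apply, Matrix.map_apply, Matrix.smul_apply, smul_eq_mul, _root_.map_mul]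
  rw [← red_coe]

omit [Fintype ι] [DecidableEq ι] in
/-- blocks of `redMat`. [cite: IwahoriMatsumoto1965, §2 (reduction mod 𝔓)] -/
theorem redMat_toBlocks₁₁ {m m' : Type*} (M : Matrix (m ⊕ m') (m ⊕ m') K) : (redMat M).toBlocks₁₁ = redMat M.toBlocks₁₁ := rfl

omit [Fintype ι] [DecidableEq ι] in
/-- blocks of `redMat`. [cite: IwahoriMatsumoto1965, §2 (reduction mod 𝔓)] -/
theorem redMat_toBlocks₂₁ {m m' : Type*} (M : Matrix (m ⊕ m') (m ⊕ m') K) : (redMat M).toBlocks₂₁ = redMat M.toBlocks₂₁ := rfl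

omit [Fintype ι] [DecidableEq ι] in
/-- `redMat (fromBlocks A B C D) = fromBlocks Ā B̄ C̄ D̄`. [cite: IwahoriMatsumoto1965, §2 (reduction mod 𝔓)] -/
theorem redMat_fromBlocks {m : Type*} (A B C D : Matrix m m K) :
    redMat (Matrix.fromBlocks A B C D) = Matrix.fromBlocks (redMat A) (redMat B) (redMat C) (redMat D) := by
  rw [redMat, Matrix.fromBlocks_map]; rfl

omit [Fintype ι] [DecidableEq ι] in
/-- `redMat 0 = 0`. [cite: IwahoriMatsumoto1965, §2 (reduction mod 𝔓)] -/
theorem redMat_zero {m m' : Type*} : redMat (0 : Matrix m m' K) = 0 := by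
  ext i j
  simp only [redMat, Matrix.map_apply, Matrix.zero_apply]
  rw [show (0 : K) = ((0 : 𝒪[K]) : K) from rfl, red_coe, map_zero]

omit [Fintype ι] [DecidableEq ι] in
/-- an integral element with non-zero residue is a unit of `𝒪` (valuation `1`). [cite: IwahoriMatsumoto1965, §2 (reduction mod 𝔓)] -/
theorem valuation_eq_one_of_red_ne_zero {x : K} (hx : x ∈ 𝒪[K]) (h : red x ≠ 0) : valuation K x = 1 := by
  have hx' : red x = IsLocalRing.residue 𝒪[K] ⟨x, hx⟩ := red_coe ⟨x, hx⟩
  rw [hx', IsLocalRing.residue_ne_zero_iff_isUnit,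
    (Valuation.integer.integers (valuation K)).isUnit_iff_valuation_eq_one] at h
  exact h

omit [Fintype ι] [DecidableEq ι] in
/-- a unit of `𝒪` has non-zero residue. [cite: IwahoriMatsumoto1965, §2 (reduction mod 𝔓)] -/
theorem red_ne_zero_of_valuation_eq_one {x : K} (h : valuation K x = 1) : red x ≠ 0 := by
  have hx : x ∈ 𝒪[K] := (Valuation.mem_integer_iff _ _).2 h.le
  have hx' : red x = IsLocalRing.residue 𝒪[K] ⟨x, hx⟩ := red_coe ⟨x, hx⟩
  rw [hx', IsLocalRing.residue_ne_zero_iff_isUnit,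
    (Valuation.integer.integers (valuation K)).isUnit_iff_valuation_eq_one]
  exact h

omit [Fintype ι] [DecidableEq ι] in
/-- blocks of an integral block matrix are integral. [cite: IwahoriMatsumoto1965, §2 (reduction mod 𝔓)] -/
theorem valBound_toBlocks {m : Type*} {M : Matrix (m ⊕ m) (m ⊕ m) K} (hM : ValBound 1 M) :
    ValBound 1 M.toBlocks₁₁ ∧ ValBound 1 M.toBlocks₁₂ ∧ ValBound 1 M.toBlocks₂₁ ∧ ValBound 1 M.toBlocks₂₂ :=
  ⟨fun i j => hM (Sum.inl i) (Sum.inl j), fun i j => hM (Sum.inl i) (Sum.inr j), fun i j => hM (Sum.inr i) (Sum.inl j),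
    fun i j => hM (Sum.inr i) (Sum.inr j)⟩

omit [Fintype ι] [DecidableEq ι] in
/-- transposes of integral matrices are integral. [cite: IwahoriMatsumoto1965, §2 (reduction mod 𝔓)] -/
theorem ValBound.transpose' {m : Type*} {M : Matrix m m K} (hM : ValBound 1 M) : ValBound 1 Mᵀ := fun i j => hM j i

/-! ## §2 An involution preserving the valuation descends to the residue field -/

section Involution

variable (σ : K →+* K)

omit [Fintype ι] [DecidableEq ι] in
/-- `σ` preserves `𝒪`. [cite: IwahoriMatsumoto1965, §2 (reduction mod 𝔓)] -/
theorem map_mem_integer (hσv : ∀ x, valuation K (σ x) = valuation K x) {x : K} (hx : x ∈ 𝒪[K]) : σ x ∈ 𝒪[K] := by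
  rw [Valuation.mem_integer_iff] at hx ⊢
  rw [hσv]; exact hx

/-- the restriction of `σ` to `𝒪`. [cite: IwahoriMatsumoto1965, §2 (reduction mod 𝔓)] -/
def integerMap (hσv : ∀ x, valuation K (σ x) = valuation K x) : 𝒪[K] →+* 𝒪[K] :=
  σ.restrict 𝒪[K] 𝒪[K] fun _ hx => map_mem_integer σ hσv hx

omit [Fintype ι] [DecidableEq ι] in
/-- `integerMap σ` is `σ` on underlying elements. [cite: IwahoriMatsumoto1965, §2 (reduction mod 𝔓)] -/
@[simp] theorem coe_integerMap_apply (hσv : ∀ x, valuation K (σ x) = valuation K x) (x : 𝒪[K]) :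
    ((integerMap σ hσv x : 𝒪[K]) : K) = σ x := rfl

/-- `integerMap σ` is a local homomorphism (it preserves the valuation, hence units). [cite: IwahoriMatsumoto1965, §2 (reduction mod 𝔓)] -/
instance isLocalHom_integerMap (hσv : ∀ x, valuation K (σ x) = valuation K x) : IsLocalHom (integerMap σ hσv) := by
  refine ⟨fun x hx => ?_⟩
  rw [(Valuation.integer.integers (valuation K)).isUnit_iff_valuation_eq_one] at hx ⊢
  change valuation K (σ (x : K)) = 1 at hx
  change valuation K (x : K) = 1
  rw [hσv] at hx
  exact hx

/-- **the induced map `σ̄` on the residue field.** [cite: IwahoriMatsumoto1965, §2 (reduction mod 𝔓)] -/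
def residueInvolution (hσv : ∀ x, valuation K (σ x) = valuation K x) : 𝓀[K] →+* 𝓀[K] :=
  IsLocalRing.ResidueField.map (integerMap σ hσv)

omit [Fintype ι] [DecidableEq ι] in
/-- `σ̄ x̄ = (σ x)‾`. [cite: IwahoriMatsumoto1965, §2 (reduction mod 𝔓)] -/
theorem residueInvolution_red (hσv : ∀ x, valuation K (σ x) = valuation K x) {x : K} (hx : x ∈ 𝒪[K]) :
    residueInvolution σ hσv (red x) = red (σ x) := by
  have h1 : red x = IsLocalRing.residue 𝒪[K] ⟨x, hx⟩ := red_coe ⟨x, hx⟩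
  have h2 : red (σ x) = IsLocalRing.residue 𝒪[K] (integerMap σ hσv ⟨x, hx⟩) := red_coe (integerMap σ hσv ⟨x, hx⟩)
  rw [h1, h2, residueInvolution, IsLocalRing.ResidueField.map_residue]

omit [Fintype ι] [DecidableEq ι] in
/-- `σ̄` is an involution if `σ` is. [cite: IwahoriMatsumoto1965, §2 (reduction mod 𝔓)] -/
theorem residueInvolution_involutive (hσv : ∀ x, valuation K (σ x) = valuation K x) (hσ : ∀ x, σ (σ x) = x) (a : 𝓀[K]) :
    residueInvolution σ hσv (residueInvolution σ hσv a) = a := by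
  obtain ⟨x, rfl⟩ := IsLocalRing.residue_surjective a
  rw [residueInvolution, IsLocalRing.ResidueField.map_residue, IsLocalRing.ResidueField.map_residue]
  congr 1
  exact Subtype.ext (hσ x)

omit [Fintype ι] [DecidableEq ι] in
/-- `redMat (M.map σ) = (redMat M).map σ̄` for integral `M`. [cite: IwahoriMatsumoto1965, §2 (reduction mod 𝔓)] -/
theorem redMat_map (hσv : ∀ x, valuation K (σ x) = valuation K x) {m m' : Type*} {M : Matrix m m' K}
    (hM : ∀ i j, M i j ∈ 𝒪[K]) :
    redMat (M.map σ) = (redMat M).map (residueInvolution σ hσv) := by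
  ext i j
  simp only [redMat, Matrix.map_apply]
  rw [residueInvolution_red σ hσv (hM i j)]

end Involution

end Literature.NumberTheory.Automorphic.IntegralReduction

end
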